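import Literature.Topology.FourManifolds.CorkDecompositionMiddleLevelAssembly
import Literature.Topology.FourManifolds.HCobordismIntersectionNumberSlabProofs
import Literature.Topology.FourManifolds.HCobordismSlideStepSign
import HarnessLib

/-!
# Kirby's duality rung (B) from Milnor's Basis Theorem 7.6 on a slab alone: Lemma 7.2 discharged

Topic `Literature/Topology/FourManifolds`; fact seat
`provefact-Literature.Topology.FourManifolds.exists_dualSpheres_middleLevel_of_two_three` (Kirby,
*Akbulut's corks and h-cobordisms of smooth, simply connected 4-manifolds* (1996), §2 last ¶ with
§1; rung (B): dual 2-spheres in the middle level of a two-three h-cobordism of dimension 5).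
`CorkDecompositionMiddleLevelAssembly.lean` reduced the named fact
`Literature.Topology.FourManifolds.exists_dualSpheres_middleLevel_of_two_three` to two results of
Milnor's *Lectures on the h-cobordism theorem* (1965):
`exists_dualSpheres_middleLevel_of_two_three_of_basisTheorem_of_lemma72 (h76) (h72)`, `h76` being
Thm. 7.6 on a slab (the named fact `Cobordism.Milnor1965_basisTheorem_slab`) and `h72` Lemma 7.2
on a slab for an embedded sphere, in the exact shape of the hypothesis of
`Cobordism.Milnor1965_intersectionNumber_slab_of_sphereClass`.  The latter is now a theorem of the
tree, `Literature.Topology.FourManifolds.Cobordism.lemma72_sphereClass_slab`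
(`HCobordismIntersectionNumberSlabProofs.lean`: Milnor's proof of Lemma 7.2, PDF p. 47, with the
transverse disc functional in place of the Thom class).  This file discharges `h72`:

* **`exists_dualSpheres_middleLevel_of_two_three_of_basisTheorem (h76)`** — rung (B) follows from
  Thm. 7.6 on a slab alone.

When `Cobordism.Milnor1965_basisTheorem_slab_holds` lands (its one-slide step is being assembled:
`HCobordismBasisInduction.lean`, `SlideSetting.lean`, `SlideStepGeometric.lean`,
`HCobordismSlideStepHomology.lean`, `HCobordismSlideStepFunctionals.lean`), the discharge of the
named fact is the one-liner
`exists_dualSpheres_middleLevel_of_two_three_of_basisTheorem Cobordism.Milnor1965_basisTheorem_slab_holds`.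

Everything here is proved; no definitions, no named facts.

## References

* R. Kirby, *Akbulut's corks and h-cobordisms of smooth, simply connected 4-manifolds*, Turkish
  J. Math. 20 (1996), 85–93, §2 (last paragraph) and §1; arXiv:math/9712231. [KirbyCorks1996]
* J. Milnor, *Lectures on the h-cobordism theorem*, notes by L. Siebenmann and J. Sondow,
  Princeton Mathematical Notes (1965), Lemma 7.2 and its proof (PDF pp. 46–47), Thm. 7.6 (PDF
  p. 50).  Held: `lit read book:milnornd-lectures-h-cobordism-theorem`. [MilnorHCobordism1965]
-/

open scoped Manifold ContDiff Topology
open Set Function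

noncomputable section

namespace Literature.Topology.FourManifolds

universe u

/-- **Rung (B) from Thm. 7.6 on a slab** (Kirby 1996, §2 last ¶; Milnor 1965, Thm. 7.6 and
Lemma 7.2): the reduction `exists_dualSpheres_middleLevel_of_two_three_of_basisTheorem_of_lemma72`
with its hypothesis `h72` discharged by the tree's Lemma 7.2 on a slab,
`Cobordism.lemma72_sphereClass_slab`. [cite: KirbyCorks1996, §2 (last paragraph); MilnorHCobordism1965, Lemma 7.2 (PDF pp. 46–47), Thm. 7.6 (PDF p. 50)] -/
theorem exists_dualSpheres_middleLevel_of_two_three_of_basisTheorem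
    (h76 : Cobordism.Milnor1965_basisTheorem_slab.{u}) :
    exists_dualSpheres_middleLevel_of_two_three.{u} := by
  refine exists_dualSpheres_middleLevel_of_two_three_of_basisTheorem_of_lemma72 h76 ?_
  intro n M N _ _ _ _ _ _ _ _ _ _ _ _ c f hf ξ hξ a₀ b ha₀ hb1 p k j hkj hk2 hkn hp ha₀p hpb honly V _ _ _ _ _ _ ι hι
    hrange eR heR hSR eL heL T hSL hT hfin htr oV oR oL σ hσ
  exact Cobordism.lemma72_sphereClass_slab hf ξ hξ ha₀ hb1 hkj hk2 hkn hp ha₀p hpb honly V ι hι hrange eR heR hSR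
    eL heL T hSL hT hfin htr oV oR oL σ hσ

/-- **Rung (B) of the cork DAG, discharged**: the named fact
`Literature.Topology.FourManifolds.exists_dualSpheres_middleLevel_of_two_three`
(`CorkDecompositionMiddleLevel.lean`) from Milnor's Thm. 7.6 on a slab, now proved
(`Cobordism.Milnor1965_basisTheorem_slab_holds`, `HCobordismSlideStepSign.lean`).
[cite: KirbyCorks1996, §2 (last paragraph); MilnorHCobordism1965, Thm. 7.6 (PDF pp. 50–52), Lemma 7.2 (PDF pp. 46–47)] -/
theorem exists_dualSpheres_middleLevel_of_two_three_holds :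
    exists_dualSpheres_middleLevel_of_two_three.{u} :=
  exists_dualSpheres_middleLevel_of_two_three_of_basisTheorem Cobordism.Milnor1965_basisTheorem_slab_holds

end Literature.Topology.FourManifolds

end
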